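import Summits.QuantumFields.YangMills.Theorems.UnitScaleTiltProp7CurvedMemberBallLetters
import Summits.QuantumFields.YangMills.Theorems.UnitScaleTiltProp7PoissonGradientDecayAllMembers
import HarnessLib

/-!
# Route `UnitScaleTilt`, crux K1 «MinimiserStabilityRegPr» (stmt-QuantumFields-19200), EX row (5) `h3` (STOREY H), H-ROAD pipeline (i) of ★CHAIR WORD №53 ∕ RECORD 17df:
# **THE LOCAL AXIAL GAUGE OF A PRINTED-REGULAR BACKGROUND IS A SMALL-FIELD GAUGE ON THE BALL** — per centre `c`, in the torus axial gauge `σ_c := axialT U₀ c` based AT `c`,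
# `‖U₀^{σ_c}(b) − 1‖ ≤ 48·ε₀·η` for every bond `b` with `tdist (e c) (e b₋) ≤ 12ℓ + 4` (`ℓ = L^{K−n}`, `η = ℓ⁻¹`, `e = siteEquiv`), from the FIRST clause of print's (8)
# (`PlaqSmall (regThreshold F n K ε₀) U₀`, i.e. `|U₀(∂p) − 1| ≤ ε₀η²`) ALONE — on a member with the no-wrap room `2(12ℓ+5) ≤ sitesPerDir 0`, and AT EVERY MEMBER on the
# `L³`-fold cover `F.cover 3` (the R-editions' lift; ✓`room_cover_three`, ✓`regPr_cover_iff`).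

WHY (px13 g16 16:03:30Z ALERT, ★CHAIR WORD №53 (1)–(3), ★★OWNER RECORD 17df).  The GLOBAL small-field letters `∀ b, ‖U₀(b) − 1‖ ≤ aη` ∕ `‖Ad U₀(b) − 1‖ ≤ ε` are NOT supplied by
[Balaban1985RegularSpaces] Thm 2 (`hThm2S` is the Landau gauge of the PERTURBATION) and are FALSE for printed-regular backgrounds with non-central Polyakov loops on few-block members
(lit ✓`FlatLatticeGaugeFields.seamConfig`: flat, every `ε₀`, `Ad`-holonomy `π`).  Print's small-field gauge is LOCAL ([Balaban1985BackgroundPropagators] (3.35) «in a suitable gauge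
`|U₀(b) − 1| < Cαη` on a cube»; [Balaban1985RegularSpaces] Thm 1 ∕ (1.29)–(1.32); [Balaban1985Averaging] pp. 24–25 «|V₀,b − 1| < |b₋ − y|α₀» for the axial gauge `V₀ = V^{v₀}`;
[Balaban1985UV3] (27)–(28)).  This file is that local gauge in the route's currency: the tree's ✓`Prop7CurvedMemberBallLetters.norm_bgOfCfg_axialT_sub_one_le_of_ball` (`‖V(z,μ) − 1‖ ≤
3R·regThreshold` on the `R`-ball, no wrap) at `R := 12ℓ + 4` with its K-free envelope ✓`ell_mul_delta_ball_le` (`ℓ·3R·regThreshold ≤ 48ε₀`) and `ℓη = 1`, read (§1) in the chart currency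
`bgOfCfg` of H2's rows (px19 ✓∕⧗`Prop7TransporterRowsOfSmallField.hRε_of_smallField`∕`hSε_of_smallField`∕`hSε'_of_bondLipschitz`, to be WINDOWED — pipeline (ii)), (§2) in the
`PBond` currency of H2b-WALK's per-centre `hsf` (✓∕⧗`Prop7AxialTransporterModulus.norm_axialT_sub_le_of_smallField_ball` — pipeline (iii)), and (§3) at every member on the cover.

Cell `ym3-torus` (HUMAN RULING D-0037; rung R3 = SU(2) YM₃ on T³ — NOT d = 4, NOT infinite volume, NOT a mass gap, NOT Clay).  Width seat `ym3-torus-px13` (gen 17);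
`--supports stmt-QuantumFields-19200 --as helper`; count-neutral; THEOREMS ONLY (0 `def`, 0 `sorry`, default heartbeats).

WHAT IS PROVED (ns `Summit.QuantumFields.YangMills.Theorems.Prop7LocalAxialGaugeSmallField`; member `F`, heights `n K`, `0 ≤ ε₀`, `σ_c := axialT U₀ c`, `V := U₀^{σ_c}`).
* §1 ★★ `norm_bgOfCfg_gaugeAct_axialT_sub_one_le` — WITH ROOM, chart currency: `PlaqSmall`, `2(12ℓ+5) ≤ sitesPerDir 0` ⟹ `‖V(z, μ) − 1‖ ≤ 48ε₀η` for `tdist (e c) z ≤ 12ℓ+4`;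
  ★ `norm_bgOfCfg_sub_bgOfCfg_le_of_ball` — the windowed two-bond row `‖V(p) − V(p′)‖ ≤ 2·48ε₀η` for `p, p′` on the ball (the `hSε'` shape at `p′ = (x − e_μ, μ)`).
* §2 ★★ `norm_gaugeAct_axialT_sub_one_le_of_ball` — WITH ROOM, `PBond` currency: `‖V(b) − 1‖ ≤ 48ε₀·η` for `tdist (e c) (e b₋) ≤ 12ℓ+4` — H2b-WALK's per-centre `hsf` with
  `a := 48ε₀`, DISCHARGED from `PlaqSmall`.
* §3 ★★★ `norm_gaugeAct_axialT_sub_one_le_of_ball_cover` ∕ `norm_bgOfCfg_gaugeAct_axialT_sub_one_le_cover` — AT EVERY MEMBER (no room): `RegPr F n K ε₀ U₀` ⟹ the same two rows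
  for the lifted background `U₀ ∘ π♭` on `F.cover 3` in the cover's axial gauge at every cover centre `ct` (room ✓`room_cover_three`; `PlaqSmall` lifts ✓`regPr_cover_iff`).
HYP-SAT (★★OWNER RULING №42).  `PlaqSmall (regThreshold …)` = `RegPr`'s first clause = print's (8) (inhabited at `U₀ = 1`); the room of §1–§2 is T1-core's class (the cover has it,
§3 displays none); conclusions non-vacuous (at `U₀ = 1`: `σ_c = 1`, `V = 1`, both sides `0 ≤ 48ε₀η`); no `Prop` hypothesis restates a conclusion.
HONEST SCOPE: the envelope arithmetic `3(12ℓ+4)·ε₀η² ≤ 48ε₀η` over two tree theorems; the axial gauge is print's [Balaban1985Averaging] p. 24 gauge, not the Landau gauge of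
[Balaban1985RegularSpaces] Thm 1; nothing of H2, `h3`, norm_G, EX, 19200 or the rung is proved; the Yang–Mills mass gap is NOT proved.

References: T. Bałaban, CMP **98** (1985) 17–51 [Balaban1985Averaging] ((8)–(9) pp.18–19, pp.24–25); CMP **99** (1985) 389–434 [Balaban1985BackgroundPropagators] ((3.35) p.396);
CMP **102** (1985) 255–275 [Balaban1985RegularSpaces] (Thm 1 p.81, (1.29)–(1.32), (1.36) p.82); CMP **102** (1985) 255–275 [Balaban1985UV3] ((27)–(28) p.263); CMP **102** (1985)
277–309 [Balaban1985Variational] ((8) p.278).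
-/

set_option autoImplicit false

noncomputable section

open scoped Matrix.Norms.L2Operator

namespace Summit.QuantumFields.YangMills.Theorems.Prop7LocalAxialGaugeSmallField

open Literature.MathematicalPhysics.QuantumFieldTheory.Balaban1983to89
open Literature.MathematicalPhysics.QuantumFieldTheory.Balaban1983to89.T3ContinuumYM3Torus
open B10Eq27TorusAxialLog (axialT)
open B4Sect5Torus (TSite tdist)
open T3RegularMinimiser (regThreshold)
open T3PrintedRegularMinimiser (RegPr)
open T3SectALandauChart (eta eta_pos)
open Summit.QuantumFields.YangMills.Theorems.Prop7SectET3Transport (periodsT3 siteEquiv bgOfCfg)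
open Summit.QuantumFields.YangMills.Theorems.AxialGaugeChartGlue (val_bgOfCfg_pair)
open Summit.QuantumFields.YangMills.Theorems.Prop7CurvedMemberBallLetters (natCast_radius norm_bgOfCfg_axialT_sub_one_le_of_ball ell_mul_delta_ball_le)
open Summit.QuantumFields.YangMills.Theorems.CoverSites
open Summit.QuantumFields.YangMills.Theorems.Prop7PoissonGradientDecayAllMembers (room_cover_three)
open Summit.QuantumFields.YangMills.Theorems.SmallMembersCoverLift (regPr_cover_iff)

variable (F : T3Family) (n K : ℕ)

/-! ## §1 With room, chart currency: `‖V(z, μ) − 1‖ ≤ 48ε₀η` on the `12ℓ+4` ball about `e c` -/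

/-- ★★ **THE LOCAL AXIAL GAUGE IS A SMALL-FIELD GAUGE ON THE BALL** (chart currency `bgOfCfg`).  For `PlaqSmall (regThreshold F n K ε₀) U₀` (`0 ≤ ε₀`) on a member with the
no-wrap room `2(12ℓ+5) ≤ sitesPerDir 0`, the background `V := U₀^{σ_c}` in the torus axial gauge `σ_c = axialT U₀ c` based at the centre `c` has `‖V(z, μ) − 1‖ ≤ 48·ε₀·η` at every
charted bond `(z, μ)` with `tdist (e c) z ≤ 12ℓ + 4` — ✓`norm_bgOfCfg_axialT_sub_one_le_of_ball` (`≤ 3R·regThreshold`, `R = 12ℓ+4`) with ✓`ell_mul_delta_ball_le` (`ℓ·3R·regThreshold ≤ 48ε₀`)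
and `ℓη = 1`.  [Balaban1985Averaging] pp. 24–25 «|V₀,b − 1| < |b₋ − y|α₀»; [Balaban1985BackgroundPropagators] (3.35) «in a suitable gauge |U₀(b) − 1| < Cαη».
[cite: Balaban1985Averaging, pp.24-25; Balaban1985BackgroundPropagators, (3.35) p.396; Balaban1985UV3, (27)-(28) p.263] -/
theorem norm_bgOfCfg_gaugeAct_axialT_sub_one_le {ε₀ : ℝ} (hε₀ : 0 ≤ ε₀)
    (U₀ : GaugeField (F.P K) 0 (Matrix.specialUnitaryGroup (Fin 2) ℂ)) (hP : PlaqSmall (regThreshold F n K ε₀) U₀)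
    (hroom : 2 * (12 * F.L ^ (K - n) + 5) ≤ (F.P K).sitesPerDir 0) (c : Site (F.P K) 0) :
    ∀ (z : TSite 3 (periodsT3 F K)) (μ : Fin 3), tdist (periodsT3 F K) (siteEquiv F K c) z ≤ 12 * (F.L : ℝ) ^ (K - n) + 4 →
      ‖((bgOfCfg F K (GaugeField.gaugeAct (axialT U₀ c) U₀) (z, μ) : (Matrix (Fin 2) (Fin 2) ℂ)ˣ) : Matrix (Fin 2) (Fin 2) ℂ) - 1‖ ≤ 48 * ε₀ * eta F n K := by
  intro z μ hz
  set R : ℕ := 12 * F.L ^ (K - n) + 4 with hRdef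
  have hRℝ : (R : ℝ) = 12 * (F.L : ℝ) ^ (K - n) + 4 := natCast_radius F n K
  have hroom' : 2 * (R + 1) ≤ (F.P K).sitesPerDir 0 := by rw [hRdef]; omega
  have h := norm_bgOfCfg_axialT_sub_one_le_of_ball F n K hε₀ U₀ hP c hroom' z μ (by rw [hRℝ]; exact hz)
  -- the envelope: `3R·regThreshold = (ℓ·3R·regThreshold)·η ≤ 48ε₀·η`
  have hL0 : (0 : ℝ) < (F.L : ℝ) := by have := F.hL.2; exact_mod_cast (lt_trans zero_lt_one this)
  have hℓ0 : (0 : ℝ) < (F.L : ℝ) ^ (K - n) := pow_pos hL0 _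
  have hη : 0 < eta F n K := eta_pos F n K
  have hℓη : (F.L : ℝ) ^ (K - n) * eta F n K = 1 := by
    unfold eta; rw [← mul_pow, mul_inv_cancel₀ hL0.ne', one_pow]
  have hℓδ : (F.L : ℝ) ^ (K - n) * (3 * (R : ℝ) * regThreshold F n K ε₀) ≤ 48 * ε₀ := by rw [hRdef]; exact ell_mul_delta_ball_le F n K hε₀
  have hconv : 3 * (R : ℝ) * regThreshold F n K ε₀ ≤ 48 * ε₀ * eta F n K := by
    have h1 : 3 * (R : ℝ) * regThreshold F n K ε₀ = ((F.L : ℝ) ^ (K - n) * (3 * (R : ℝ) * regThreshold F n K ε₀)) * eta F n K := by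
      calc 3 * (R : ℝ) * regThreshold F n K ε₀ = 3 * (R : ℝ) * regThreshold F n K ε₀ * ((F.L : ℝ) ^ (K - n) * eta F n K) := by rw [hℓη, mul_one]
        _ = _ := by ring
    rw [h1]
    exact mul_le_mul_of_nonneg_right hℓδ hη.le
  exact h.trans hconv

/-- ★ **THE WINDOWED TWO-BOND ROW** (the `hSε'` shape of px19's ✓∕⧗`Prop7TransporterRowsOfSmallField.hSε'_of_bondLipschitz` at `p′ = (x − e_μ, μ)`, windowed): for two charted bonds
`p, p′` whose sources lie in the `12ℓ+4` ball about `e c`, `‖V(p) − V(p′)‖ ≤ 2·(48ε₀η)`, `V := U₀^{σ_c}` (§1 twice and the triangle inequality through `1`).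
[cite: Balaban1985BackgroundPropagators, (3.35) p.396; Balaban1985RegularSpaces, (1.36)-(1.37) p.82] -/
theorem norm_bgOfCfg_sub_bgOfCfg_le_of_ball {ε₀ : ℝ} (hε₀ : 0 ≤ ε₀)
    (U₀ : GaugeField (F.P K) 0 (Matrix.specialUnitaryGroup (Fin 2) ℂ)) (hP : PlaqSmall (regThreshold F n K ε₀) U₀)
    (hroom : 2 * (12 * F.L ^ (K - n) + 5) ≤ (F.P K).sitesPerDir 0) (c : Site (F.P K) 0) :
    ∀ (p p' : TSite 3 (periodsT3 F K) × Fin 3), tdist (periodsT3 F K) (siteEquiv F K c) p.1 ≤ 12 * (F.L : ℝ) ^ (K - n) + 4 →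
      tdist (periodsT3 F K) (siteEquiv F K c) p'.1 ≤ 12 * (F.L : ℝ) ^ (K - n) + 4 →
      ‖((bgOfCfg F K (GaugeField.gaugeAct (axialT U₀ c) U₀) p : (Matrix (Fin 2) (Fin 2) ℂ)ˣ) : Matrix (Fin 2) (Fin 2) ℂ)
          - ((bgOfCfg F K (GaugeField.gaugeAct (axialT U₀ c) U₀) p' : (Matrix (Fin 2) (Fin 2) ℂ)ˣ) : Matrix (Fin 2) (Fin 2) ℂ)‖ ≤ 2 * (48 * ε₀ * eta F n K) := by
  intro p p' hp hp'
  have h1 := norm_bgOfCfg_gaugeAct_axialT_sub_one_le F n K hε₀ U₀ hP hroom c p.1 p.2 hp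
  have h2 := norm_bgOfCfg_gaugeAct_axialT_sub_one_le F n K hε₀ U₀ hP hroom c p'.1 p'.2 hp'
  calc _ ≤ ‖((bgOfCfg F K (GaugeField.gaugeAct (axialT U₀ c) U₀) p : (Matrix (Fin 2) (Fin 2) ℂ)ˣ) : Matrix (Fin 2) (Fin 2) ℂ) - 1‖
        + ‖((bgOfCfg F K (GaugeField.gaugeAct (axialT U₀ c) U₀) p' : (Matrix (Fin 2) (Fin 2) ℂ)ˣ) : Matrix (Fin 2) (Fin 2) ℂ) - 1‖ := by
          rw [← norm_neg (((bgOfCfg F K (GaugeField.gaugeAct (axialT U₀ c) U₀) p' : (Matrix (Fin 2) (Fin 2) ℂ)ˣ) : Matrix (Fin 2) (Fin 2) ℂ) - 1)]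
          refine (norm_add_le _ _).trans_eq' ?_
          congr 1; abel
    _ ≤ _ := by linarith

/-! ## §2 With room, `PBond` currency: H2b-WALK's per-centre `hsf` with `a := 48ε₀`, discharged -/

/-- ★★ **H2b-WALK's PER-CENTRE SMALL-FIELD CLAUSE, DISCHARGED FROM `PlaqSmall`**: on a member with room `2(12ℓ+5) ≤ sitesPerDir 0`, for every bond `b` with
`tdist (e c) (e b₋) ≤ 12ℓ + 4`: `‖U₀^{σ_c}(b) − 1‖ ≤ (48ε₀)·η`, `σ_c = axialT U₀ c` — the `hsf` hypothesis of ✓∕⧗`Prop7AxialTransporterModulus.norm_axialT_sub_le_of_smallField_ball` for the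
re-gauged background `U₀^{σ_c}` with `a := 48ε₀` (§1 at the charted bond `(e b₋, dir b)`, ✓`val_bgOfCfg_pair`).
[cite: Balaban1985Averaging, pp.24-25; Balaban1985BackgroundPropagators, (3.35) p.396; Balaban1985RegularSpaces, (1.36) p.82] -/
theorem norm_gaugeAct_axialT_sub_one_le_of_ball {ε₀ : ℝ} (hε₀ : 0 ≤ ε₀)
    (U₀ : GaugeField (F.P K) 0 (Matrix.specialUnitaryGroup (Fin 2) ℂ)) (hP : PlaqSmall (regThreshold F n K ε₀) U₀)
    (hroom : 2 * (12 * F.L ^ (K - n) + 5) ≤ (F.P K).sitesPerDir 0) (c : Site (F.P K) 0) :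
    ∀ b : PBond (F.P K) 0, tdist (periodsT3 F K) (siteEquiv F K c) (siteEquiv F K b.src) ≤ 12 * (F.L : ℝ) ^ (K - n) + 4 →
      ‖((GaugeField.gaugeAct (axialT U₀ c) U₀ b : Matrix.specialUnitaryGroup (Fin 2) ℂ) : Matrix (Fin 2) (Fin 2) ℂ) - 1‖ ≤ 48 * ε₀ * eta F n K := by
  intro b hb
  have h := norm_bgOfCfg_gaugeAct_axialT_sub_one_le F n K hε₀ U₀ hP hroom c (siteEquiv F K b.src) b.dir hb
  rwa [val_bgOfCfg_pair, Equiv.symm_apply_apply] at h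

/-! ## §3 ★★★ At every member: the same rows for the lifted background on the `L³`-fold cover -/

/-- ★★★ **AT EVERY MEMBER (no room), `PBond` currency**: for `RegPr F n K ε₀ U₀` (`0 ≤ ε₀`) and every centre `ct` of the cover `F.cover 3`, the lifted background `Ũ := U₀ ∘ π♭`
in the cover's axial gauge `σ̃_ct = axialT Ũ ct` has `‖Ũ^{σ̃_ct}(b̃) − 1‖ ≤ (48ε₀)·η` for every cover bond `b̃` with `tdist (ẽ ct) (ẽ b̃₋) ≤ 12ℓ + 4` — §2 on the cover (room
✓`room_cover_three`, `PlaqSmall` by ✓`regPr_cover_iff`; same `L`, same `η`).  This is the per-centre `hsf` of H2b-WALK ∕ BRIDGE v2 on the R-editions' carrier, from `RegPr` ALONE.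
[cite: Balaban1985Averaging, pp.24-25; Balaban1985BackgroundPropagators, (3.35) p.396; Balaban1985Variational, (8) p.278] -/
theorem norm_gaugeAct_axialT_sub_one_le_of_ball_cover {ε₀ : ℝ} (hε₀ : 0 ≤ ε₀)
    (U₀ : GaugeField (F.P K) 0 (Matrix.specialUnitaryGroup (Fin 2) ℂ)) (hreg : RegPr F n K ε₀ U₀) (ct : Site ((F.cover 3).P K) 0) :
    ∀ bt : PBond ((F.cover 3).P K) 0,
      tdist (periodsT3 (F.cover 3) K) (siteEquiv (F.cover 3) K ct) (siteEquiv (F.cover 3) K bt.src) ≤ 12 * (F.L : ℝ) ^ (K - n) + 4 →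
      ‖((GaugeField.gaugeAct (axialT (U₀ ∘ projBond (F.P K) 3 0) ct) (U₀ ∘ projBond (F.P K) 3 0) bt : Matrix.specialUnitaryGroup (Fin 2) ℂ) : Matrix (Fin 2) (Fin 2) ℂ) - 1‖
        ≤ 48 * ε₀ * eta F n K :=
  norm_gaugeAct_axialT_sub_one_le_of_ball (F.cover 3) n K hε₀ (U₀ ∘ projBond (F.P K) 3 0) ((regPr_cover_iff 3 F ε₀ U₀).mpr hreg).1 (room_cover_three F n K) ct

/-- ★★★ **AT EVERY MEMBER (no room), chart currency**: the same in the `bgOfCfg` currency of H2's rows — for `RegPr F n K ε₀ U₀` and every cover centre `ct`,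
`‖Ṽ(z̃, μ) − 1‖ ≤ 48ε₀η` for `tdist (ẽ ct) z̃ ≤ 12ℓ + 4`, `Ṽ := (U₀ ∘ π♭)^{σ̃_ct}` (§1 on the cover) — the WINDOWED `hRε`∕`hSε` input of pipeline (ii) at the lift.
[cite: Balaban1985Averaging, pp.24-25; Balaban1985BackgroundPropagators, (3.35) p.396; Balaban1985Variational, (8) p.278] -/
theorem norm_bgOfCfg_gaugeAct_axialT_sub_one_le_cover {ε₀ : ℝ} (hε₀ : 0 ≤ ε₀)
    (U₀ : GaugeField (F.P K) 0 (Matrix.specialUnitaryGroup (Fin 2) ℂ)) (hreg : RegPr F n K ε₀ U₀) (ct : Site ((F.cover 3).P K) 0) :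
    ∀ (zt : TSite 3 (periodsT3 (F.cover 3) K)) (μ : Fin 3), tdist (periodsT3 (F.cover 3) K) (siteEquiv (F.cover 3) K ct) zt ≤ 12 * (F.L : ℝ) ^ (K - n) + 4 →
      ‖((bgOfCfg (F.cover 3) K (GaugeField.gaugeAct (axialT (U₀ ∘ projBond (F.P K) 3 0) ct) (U₀ ∘ projBond (F.P K) 3 0)) (zt, μ) : (Matrix (Fin 2) (Fin 2) ℂ)ˣ) :
          Matrix (Fin 2) (Fin 2) ℂ) - 1‖ ≤ 48 * ε₀ * eta F n K :=
  norm_bgOfCfg_gaugeAct_axialT_sub_one_le (F.cover 3) n K hε₀ (U₀ ∘ projBond (F.P K) 3 0) ((regPr_cover_iff 3 F ε₀ U₀).mpr hreg).1 (room_cover_three F n K) ct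

end Summit.QuantumFields.YangMills.Theorems.Prop7LocalAxialGaugeSmallField

end
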